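import Summits.BirchSwinnertonDyer.Uniform.U2.RingClassSplitStep
import Literature.NumberTheory.EllipticCurves.Darmon2004.HeegnerNormCompatibilitySplitRamifiedHeckeProofs
import Literature.NumberTheory.EllipticCurves.HeegnerTraceRelationProofs
import Literature.NumberTheory.QuadraticFields.RingClassNumberFormula
import HarnessLib

/-!
# Cell «bsd-uniform», track U2, route C — Theorem A′ (first half) for EVERY square-free conductor prime
# to `2·N·d_K`: the COMPOSED TRACE `Tr_{K[n]/K} y_n = (∏_{inert} a_q · ∏_{split} (a_q − 2)) · y_K` as a
# KERNEL THEOREM for every Heegner field with `d_K < −4` — residue R2-11 (split primes) CLOSED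

HONEST FRAMING (cell «bsd-uniform», run/shared/lean/pub/bsd-uniform/, seat u2-p1): a THEOREM under
named binders, no claim about BSD beyond it; nothing booked, no census number moved, no per-curve
certificate counted as uniform. `GenusPointRingClassSquarefree.lean` (p503242) proved route C's
composed trace relation for square-free `n` all of whose primes are INERT in CLTZ's field `ℚ(√−ℓ₀)`;
HOME/RESIDUE.md R2-11 kept «htr for `d` with a SPLIT prime factor» open — the printed one-step input
(Darmon 2004 Prop. 3.10 (2)) being false as typed at `n = 1` (ue-lit g14) and its reciprocity half
unproved — and the general-`K` heads take `y`, `htr` as hypotheses. Since ue-lit g15's p530045 the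
HECKE HALF of the split step is a Literature theorem in consumer shape,
`Σ_{τ ∈ Gal(K[Mℓ]/K[M])} τ·y = a_ℓ·y_M − G₁ y_M − G₂ y_M` for SOME `G₁, G₂ ∈ Gal(K[Mℓ]/K)` under the unit
correction `2 ≤ M ∨ d_K < −4` — and that is all the trace to `K` needs (`RingClassSplitStep.lean`:
`Gal(K[n]/K)` is abelian and fixes `y_K`); the inert step for a GENERAL Heegner field is the tree theorem
`HeegnerTrace.finsum_mem_ringClassGalOver_eq_frobeniusTrace_smul` (Gross 1991 Prop. 3.7 (1) / Darmon
3.10 (1) / CLTZ 2015 Lemma 2.9, under the same unit correction). This file runs the tower induction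
with BOTH kinds of steps, for every imaginary quadratic `K` with `d_K < −4` (Gross's `D ≠ 3, 4`) and
the Heegner hypothesis, and every square-free `n` prime to `2·N·d_K` (so every `p ∣ n` is inert,
`(d_K/p) = −1`, or split, `(d_K/p) = 1`) with all `a_p` odd: `Σ_{σ ∈ Gal(K[n]/K)} σ·y_n = m₀·y_K` with
`m₀ = ∏_{inert} a_p · ∏_{split} (a_p − 2)` ODD. The induction runs over the divisors `M ∣ n` INSIDE
`Gal(K[n]/K)` (statement: the trace of `incl_{M→n}(z_M)` over `G / Gal(K[n]/K[M])` is an odd multiple of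
`y_K`), base `M = 1` = Gross's (4.1) `hyK`, intermediate Heegner points from the PROVED rationality
theorem, as in p503242.

## Contents (theorems only; no `def`, no named fact)
* `exists_odd_sum_quotient_eq_smul` — the induction over `M ∣ n` inside `Gal(K[n]/K)`.
* `sum_subgroupOf_ringClassGalOver_self` — `Gal(K[n]/K[n]) = 1` inside `Gal(K[n]/K)`.
* **`exists_odd_sum_ringClassGal_eq_smul`** — the heads' `htr` with an ODD `m₀`, every square-free `n`
  prime to `2·N·d_K` with odd `a_p`, every `K` with `d_K < −4`.
* **`genusPoint_not_isOfFinAddOrder_squarefree`** — Theorem A′ (first half): `Σ_σ s(σ)·σy` has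
  infinite order, for L1 and (H-y).

References: Coates–Li–Tian–Zhai 2015 Lemma 2.9 [CoatesLiTianZhai2015]; Darmon 2004 Prop. 3.10
[Darmon2004]; Gross 1991 §1 (D ≠ 3, 4), §3–§4, (4.1) [GrossLMS1991]; Cox 2013 §5.B Prop. 5.16
(decomposition law) [Cox2013]; Bradshaw–Stein, J. Number Theory 132 (2012) §3; T4-PROOF.md v1.9b §3–§4
(HOME).
-/

noncomputable section

open scoped Classical

open WeierstrassCurve NumberField Literature.NumberTheory.EllipticCurves
  Literature.NumberTheory.EllipticCurves.ModularForms Summit.BirchSwinnertonDyer.Rank1Residual.X11b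

set_option autoImplicit false

namespace Summit.BirchSwinnertonDyer.Uniform.U2.RingClass

variable {K : Type} [Field K] [NumberField K] (ι : K →+* ℂ) (hK : IsImaginaryQuadratic K)

/-! ## §4 The composed trace for EVERY square-free conductor prime to `N·d_K` (inert AND split primes) -/

/-- **THE COMPOSED TRACE RELATION, INERT AND SPLIT PRIMES MIXED, by induction over the tower inside
`Gal(K[n]/K)`.** Standing data: `E/ℚ` globally minimal of conductor `N`, an imaginary quadratic Heegner
field `K` with `d_K < −4` (Gross's `D ≠ 3, 4`: the unit index of every order of `K` is `1`, so Darmon's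
unit correction `hu` holds at every level), the Heegner hypothesis for `N`, `ι`, `Dt`, `β`; the level-`1`
datum `y₁ ∈ E(K[1])` over `x(1)` and Gross's (4.1) `Tr_{K[1]/K} y₁ = y_K` read in `E(K[n])` (`hyK`). Let
`n` be square-free, odd, prime to `N` and to `d_K` (so every prime `p ∣ n` is INERT or SPLIT in `K` —
`(d_K/p) = ∓1`), with `a_p` odd for every `p ∣ n`. Then for every `M ∣ n` and every
`z ∈ E(K[M])` over `x(M)`: `Σ_{c ∈ Gal(K[n]/K)/Gal(K[n]/K[M])} c̃ · incl_{M→n}(z) = m · y_K` for some ODD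
integer `m` (namely `∏_{p ∣ M inert} a_p · ∏_{p ∣ M split} (a_p − 2)`). Induction on `M`: the base is
`hyK` (a point over `x(1)` IS `y₁` in `E(K[n])`); the step `M = M'p` uses at `K[M]/K[M']` the PROVED
one-step inputs — Gross 3.7 (1) / CLTZ 2.9 with the unit hypothesis
(`HeegnerTrace.finsum_mem_ringClassGalOver_eq_frobeniusTrace_smul`) for `p` inert, Darmon 2004
Prop. 3.10 (2) in its Hecke-half consumer shape for `p` split
(`Darmon2004.exists_finsum_pointGalHom_eq_frobeniusTrace_smul_sub_sub_of_split`, ue-lit g15 p530045;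
the unknown `G₁, G₂ ∈ Gal(K[M]/K)` standing in for `σ_λ, σ_λ̄` are harmless for the trace to `K`) —
the intermediate Heegner point `z' ∈ E(K[M'])` from the rationality theorem, and §3's folds.
[cite: CoatesLiTianZhai2015, Lemma 2.9 (general fact)] [cite: Darmon2004, Prop. 3.10 (2)]
[cite: GrossLMS1991, §1 (D ≠ 3, 4), §3 (x_n rational over K_n; Prop. 3.7 (1); 𝒢_n abelian) and §4 (4.1)] -/
theorem exists_odd_sum_quotient_eq_smul
    (W : WeierstrassCurve ℚ) [W.IsElliptic] [W.IsGloballyMinimal] [NeZero (W.conductorNorm ℤ)]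
    -- Gross's unit hypothesis `d_K ≠ −3, −4` (here `d_K < −4`), and the Heegner hypothesis
    (hdK : NumberField.discr K < -4)
    (hH : SatisfiesHeegnerHypothesis (W.conductorNorm ℤ) K)
    (Dt : ModularParametrizationData W (W.conductorNorm ℤ)) (β : ℤ)
    (hβ : (4 * (W.conductorNorm ℤ : ℤ)) ∣ β ^ 2 - NumberField.discr K)
    (y₁ : (W.baseChange (ringClassField K ι 1 : Type)).toAffine.Point)
    (hy₁ : WeierstrassCurve.Affine.Point.map (ringClassField K ι 1).subtype.toRatAlgHom y₁ =
      heegnerPointComplexOfConductor Dt (NumberField.discr K) β 1)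
    (n : ℕ) [NumberField (ringClassField K ι n)] (hn : n ≠ 0) (hsq : Squarefree n)
    (hnC : Nat.Coprime n (W.conductorNorm ℤ)) (hn2 : ¬ 2 ∣ n)
    (hnD : Nat.Coprime n (NumberField.discr K).natAbs)
    (hodd : ∀ p : ℕ, p.Prime → p ∣ n → Odd (W.frobeniusTrace p))
    (yK : (W.baseChange K).toAffine.Point)
    (hyK : ∑ c : ringClassGal ι n ⧸ (ringClassGalOver ι n 1).subgroupOf (ringClassGal ι n),
        pointGalHom W (ringClassField K ι n) (c.out : ringClassGal ι n).1
          (WeierstrassCurve.Affine.Point.map (W' := W)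
            (RingClassField.inclusion ι
              (ringClassField_mono hK ι (one_dvd n) hn)).toRingHom.toRatAlgHom y₁) =
      WeierstrassCurve.Affine.Point.map (W' := W)
        (algebraMap K (ringClassField K ι n)).toRatAlgHom yK)
    (M : ℕ) (hMn : M ∣ n)
    {instQ : Fintype (ringClassGal ι n ⧸ (ringClassGalOver ι n M).subgroupOf (ringClassGal ι n))}
    (z : (W.baseChange (ringClassField K ι M : Type)).toAffine.Point)
    (hz : WeierstrassCurve.Affine.Point.map (ringClassField K ι M).subtype.toRatAlgHom z =
      heegnerPointComplexOfConductor Dt (NumberField.discr K) β M) :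
    ∃ m : ℤ, Odd m ∧
      ∑ c : ringClassGal ι n ⧸ (ringClassGalOver ι n M).subgroupOf (ringClassGal ι n),
        pointGalHom W (ringClassField K ι n) (c.out : ringClassGal ι n).1
          (WeierstrassCurve.Affine.Point.map (W' := W)
            (RingClassField.inclusion ι (ringClassField_mono hK ι hMn hn)).toRingHom.toRatAlgHom z) =
      m • WeierstrassCurve.Affine.Point.map (W' := W)
        (algebraMap K (ringClassField K ι n)).toRatAlgHom yK := by
  induction M using Nat.strong_induction_on with
  | _ M ih =>
  have hM0 : M ≠ 0 := ne_zero_of_dvd hMn hn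
  by_cases h1 : M = 1
  · -- BASE `M = 1`: `incl z = incl y₁` (same complex coordinates), then Gross's (4.1)
    subst h1
    refine ⟨1, odd_one, ?_⟩
    have hzy : WeierstrassCurve.Affine.Point.map (W' := W)
        (RingClassField.inclusion ι (ringClassField_mono hK ι hMn hn)).toRingHom.toRatAlgHom z =
        WeierstrassCurve.Affine.Point.map (W' := W)
          (RingClassField.inclusion ι (ringClassField_mono hK ι (one_dvd n) hn)).toRingHom.toRatAlgHom y₁ := by
      apply WeierstrassCurve.Affine.Point.map_injective (W' := W)
        (f := (ringClassField K ι n).subtype.toRatAlgHom)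
      rw [map_subtype_map_inclusion ι hK hMn hn W z, map_subtype_map_inclusion ι hK (one_dvd n) hn W y₁,
        hz, hy₁]
    rw [one_smul, hzy]
    convert hyK using 3
  · -- STEP `M = M' * p`
    obtain ⟨p, hp, hpM⟩ := Nat.exists_prime_and_dvd h1
    obtain ⟨M', hM'⟩ : ∃ M', M = M' * p := ⟨M / p, (Nat.div_mul_cancel hpM).symm⟩
    subst hM'
    have hM'0 : M' ≠ 0 := fun h => hM0 (by rw [h, zero_mul])
    have hM'M : M' ∣ M' * p := Dvd.intro p rfl
    have hM'n : M' ∣ n := hM'M.trans hMn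
    have hpn : p ∣ n := (Dvd.intro_left M' rfl).trans hMn
    have hsqM : Squarefree (M' * p) := fun x hx => hsq x (hx.trans hMn)
    have hcop : Nat.Coprime M' p := (Nat.squarefree_mul_iff.mp hsqM).1
    have hpM' : ¬ p ∣ M' := fun h => hp.ne_one ((Nat.coprime_comm.mp hcop).eq_one_of_dvd h)
    have hM'C : Nat.Coprime M' (W.conductorNorm ℤ) := Nat.Coprime.of_dvd_left hM'n hnC
    have hpC : Nat.Coprime p (W.conductorNorm ℤ) := Nat.Coprime.of_dvd_left hpn hnC
    have hM'lt : M' < M' * p := lt_mul_of_one_lt_right (Nat.pos_of_ne_zero hM'0) hp.one_lt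
    have hp2 : p ≠ 2 := fun h => hn2 (h ▸ hpn)
    haveI hNF : NumberField (ringClassField K ι (M' * p)) := numberField_ringClassField ι hK _ hM0
    haveI hNF' : NumberField (ringClassField K ι M') := numberField_ringClassField ι hK M' hM'0
    -- the Heegner point of conductor `M'` is `K[M']`-rational (tree theorem); induction hypothesis
    obtain ⟨z', hz'⟩ := phi_heegnerPointOfConductor_mem_range_map_ringClassField_holds
      (W.conductorNorm ℤ) W K hK hH Dt β ι M' hβ hM'0 hM'C
    obtain ⟨m, hm, hIH⟩ := ih M' hM'lt hM'n (instQ := inferInstance) z' hz'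
    -- `z'` read in `E(K[M'p])`, over `x(M')`
    have hz'L : WeierstrassCurve.Affine.Point.map (ringClassField K ι (M' * p)).subtype.toRatAlgHom
        (WeierstrassCurve.Affine.Point.map (W' := W)
          (RingClassField.inclusion ι (ringClassField_mono hK ι hM'M hM0)).toRingHom.toRatAlgHom z') =
        heegnerPointComplexOfConductor Dt (NumberField.discr K) β M' := by
      rw [map_subtype_map_inclusion ι hK hM'M hM0 W z', hz']
    -- `p` is inert or split in `K` (`p ≠ 2`, `p ∤ d_K`)
    have hgcd : (NumberField.discr K).gcd p = 1 := by
      rw [Int.gcd, Int.natAbs_natCast]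
      exact (Nat.Coprime.coprime_dvd_left hpn hnD).symm
    rcases jacobiSym.eq_one_or_neg_one hgcd with hsplit | hinert
    · -- SPLIT: Darmon 3.10 (2), Hecke half (ue-lit g15), with lifted `G₁, G₂`
      have hsplit' : ((Ideal.span {(p : ℤ)}).primesOver (𝓞 K)).ncard = 2 :=
        (Literature.NumberTheory.QuadraticFields.Quadratic.ncard_primesOver_eq_two_iff_jacobiSym hK.1 hp
          hp2).mpr hsplit
      have hu : 2 ≤ M' ∨ NumberField.discr K < -4 := Or.inr hdK
      obtain ⟨G₁, hG₁, G₂, hG₂, hrel⟩ :=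
        Darmon2004.exists_finsum_pointGalHom_eq_frobeniusTrace_smul_sub_sub_of_split W K hK hH ι Dt β hβ
          M' hM'0 hM'C p hp hpC hpM' hsplit' hu z _ hz hz'L
      refine ⟨(W.frobeniusTrace p - 2) * m,
        ((GenusCongruence.odd_sub_two_iff _).mpr (hodd p hp hpn)).mul hm, ?_⟩
      convert sum_quotient_eq_sub_two_mul_smul_of_split_step ι hK hMn hn hM'M W z z'
        (W.frobeniusTrace p) m G₁ G₂ hG₁ hG₂ hrel yK hIH using 2
    · -- INERT: Gross 3.7 (1) / Darmon 3.10 (1) / CLTZ 2.9 with the unit hypothesis (tree theorem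
      -- `HeegnerTrace.finsum_mem_ringClassGalOver_eq_frobeniusTrace_smul`), pulled back to `E(K[M'p])`
      have hinert' : (Ideal.span {(p : 𝓞 K)}).IsPrime :=
        (Literature.NumberTheory.QuadraticFields.RingClass.isPrime_span_natCast_iff_jacobiSym_eq_neg_one
          hK.1 hp hp2).mpr hinert
      have hND : IsCoprime (W.conductorNorm ℤ : ℤ) (NumberField.discr K) := by
        refine Int.isCoprime_iff_gcd_eq_one.mpr ?_
        rw [Int.gcd_eq_natAbs, Int.natAbs_natCast]
        exact Literature.SatisfiesHeegnerHypothesis.coprime_discr hK.1 hH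
      have hpN : ¬ p ∣ W.conductorNorm ℤ := (Nat.Prime.coprime_iff_not_dvd hp).mp hpC
      have hrelC := HeegnerTrace.finsum_mem_ringClassGalOver_eq_frobeniusTrace_smul hK ι Dt hND hβ hp
        hinert' hpN hpM' hM'0 hM'C.symm (Or.inr hdK) (Nat.mul_comm p M') hz
      rw [← hz'L] at hrelC
      have htop := sum_pointGalHom_eq_smul_of_finsum ι (M' * p) W M' z _ _ hrelC
      refine ⟨W.frobeniusTrace p * m, (hodd p hp hpn).mul hm, ?_⟩
      convert sum_quotient_eq_mul_smul_of_inert_step ι hK hMn hn hM'M W z z' (W.frobeniusTrace p) m htop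
        yK hIH using 2


/-! ## §5 Down to `Gal(K[n]/K)`: the heads' `htr` with an ODD multiplier, and Theorem A′ (first half) -/

/-- The trace over the trivial group `Gal(K[n]/K[n])`, read inside `Gal(K[n]/K)`, is the identity.
[folklore] -/
theorem sum_subgroupOf_ringClassGalOver_self (W : WeierstrassCurve ℚ) {n : ℕ}
    [Fintype ((ringClassGalOver ι n n).subgroupOf (ringClassGal ι n))]
    (P : (W.baseChange (ringClassField K ι n : Type)).toAffine.Point) :
    ∑ h : (ringClassGalOver ι n n).subgroupOf (ringClassGal ι n),
      pointGalHom W (ringClassField K ι n) ((h : ringClassGal ι n)).1 P = P := by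
  have huniv : (Finset.univ : Finset ((ringClassGalOver ι n n).subgroupOf (ringClassGal ι n))) = {1} := by
    ext τ
    simp only [Finset.mem_univ, Finset.mem_singleton, true_iff]
    have h1 : (⟨(τ : ringClassGal ι n).1, Subgroup.mem_subgroupOf.mp τ.2⟩ : ringClassGalOver ι n n) = 1 :=
      eq_one_of_mem_ringClassGalOver_self ι _
    have h2 : (τ : ringClassGal ι n).1 = 1 := congrArg Subtype.val h1
    exact Subtype.ext (Subtype.ext h2)
  rw [huniv, Finset.sum_singleton, OneMemClass.coe_one, OneMemClass.coe_one, map_one]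
  rfl

/-- **THE COMPOSED TRACE RELATION over `Gal(K[n]/K)` with an ODD multiplier — literally the end-to-end
heads' binder `htr` (with `hm₀`) — for EVERY square-free `n` prime to `2·N·d_K` with all `a_p` (`p ∣ n`)
odd, over EVERY Heegner field `K` with `d_K < −4`.** The prime factors of `n` may be INERT or SPLIT in `K`
(they are one or the other, `(n, d_K) = 1`). Under the binders of `exists_odd_sum_quotient_eq_smul` and for
`y ∈ E(K[n])` over `x(n)`: `Σ_{σ ∈ Gal(K[n]/K)} σ·y = m₀ · y_K` in `E(K[n])` for some odd `m₀`
(= `∏_{p inert} a_p · ∏_{p split} (a_p − 2)`). Supersedes `sum_ringClassGal_eq_prod_smul_of_inert`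
(p503242: all primes inert). [cite: CoatesLiTianZhai2015, Lemma 2.9 (general fact)]
[cite: Darmon2004, Prop. 3.10 (2)] [cite: GrossLMS1991, §3 and §4 (4.1)] -/
theorem exists_odd_sum_ringClassGal_eq_smul
    (W : WeierstrassCurve ℚ) [W.IsElliptic] [W.IsGloballyMinimal] [NeZero (W.conductorNorm ℤ)]
    -- Gross's unit hypothesis `d_K ≠ −3, −4` (here `d_K < −4`), and the Heegner hypothesis
    (hdK : NumberField.discr K < -4)
    (hH : SatisfiesHeegnerHypothesis (W.conductorNorm ℤ) K)
    (Dt : ModularParametrizationData W (W.conductorNorm ℤ)) (β : ℤ)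
    (hβ : (4 * (W.conductorNorm ℤ : ℤ)) ∣ β ^ 2 - NumberField.discr K)
    (y₁ : (W.baseChange (ringClassField K ι 1 : Type)).toAffine.Point)
    (hy₁ : WeierstrassCurve.Affine.Point.map (ringClassField K ι 1).subtype.toRatAlgHom y₁ =
      heegnerPointComplexOfConductor Dt (NumberField.discr K) β 1)
    (n : ℕ) [NumberField (ringClassField K ι n)] (hn : n ≠ 0) (hsq : Squarefree n)
    (hnC : Nat.Coprime n (W.conductorNorm ℤ)) (hn2 : ¬ 2 ∣ n)
    (hnD : Nat.Coprime n (NumberField.discr K).natAbs)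
    (hodd : ∀ p : ℕ, p.Prime → p ∣ n → Odd (W.frobeniusTrace p))
    (y : (W.baseChange (ringClassField K ι n : Type)).toAffine.Point)
    (hy : WeierstrassCurve.Affine.Point.map (ringClassField K ι n).subtype.toRatAlgHom y =
      heegnerPointComplexOfConductor Dt (NumberField.discr K) β n)
    (yK : (W.baseChange K).toAffine.Point)
    (hyK : ∑ c : ringClassGal ι n ⧸ (ringClassGalOver ι n 1).subgroupOf (ringClassGal ι n),
        pointGalHom W (ringClassField K ι n) (c.out : ringClassGal ι n).1
          (WeierstrassCurve.Affine.Point.map (W' := W)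
            (RingClassField.inclusion ι
              (ringClassField_mono hK ι (one_dvd n) hn)).toRingHom.toRatAlgHom y₁) =
      WeierstrassCurve.Affine.Point.map (W' := W)
        (algebraMap K (ringClassField K ι n)).toRatAlgHom yK) :
    ∃ m₀ : ℤ, Odd m₀ ∧
      ∑ σ : ringClassGal ι n, pointGalHom W (ringClassField K ι n) σ.1 y =
        m₀ • WeierstrassCurve.Affine.Point.map (W' := W)
          (algebraMap K (ringClassField K ι n)).toRatAlgHom yK := by
  obtain ⟨m₀, hm₀, hQ⟩ := exists_odd_sum_quotient_eq_smul ι hK W hdK hH Dt β hβ y₁ hy₁ n hn hsq hnC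
    hn2 hnD hodd yK hyK n (dvd_refl n) (instQ := inferInstance) y hy
  refine ⟨m₀, hm₀, ?_⟩
  -- `incl_{n→n} y = y` (same complex coordinates)
  have hyy : WeierstrassCurve.Affine.Point.map (W' := W)
      (RingClassField.inclusion ι (ringClassField_mono hK ι (dvd_refl n) hn)).toRingHom.toRatAlgHom y = y := by
    apply WeierstrassCurve.Affine.Point.map_injective (W' := W)
      (f := (ringClassField K ι n).subtype.toRatAlgHom)
    rw [map_subtype_map_inclusion ι hK (dvd_refl n) hn W y]
  rw [hyy] at hQ
  -- the total trace is the trace over `G / Gal(K[n]/K[n])`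
  have hdec := GenusCongruence.sum_eq_sum_quotient_sum_subgroup
    ((pointGalHom W (ringClassField K ι n)).comp (ringClassGal ι n).subtype)
    ((ringClassGalOver ι n n).subgroupOf (ringClassGal ι n)) y
  simp only [MonoidHom.comp_apply, Subgroup.coe_subtype] at hdec
  rw [hdec]
  simp_rw [sum_subgroupOf_ringClassGalOver_self ι W y]
  convert hQ using 3

/-- **Theorem A′, first half, for EVERY square-free conductor prime to `2·N·d_K` supported on `a_q`-odd
primes (inert or split in `K`, `d_K < −4`).** Under the binders of `exists_odd_sum_ringClassGal_eq_smul`,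
with L1 `E(K[n])[2] = 0` (`h2L`) and (H-y) `y_K ∉ 2E(K)` (`hHy`): for every sign function `s` on
`Gal(K[n]/K)` — in particular the genus character `χ_d` — the point `Σ_σ s(σ)·σy` has infinite order in
`E(K[n])`. Supersedes `genusPoint_not_isOfFinAddOrder_inert_squarefree` (p503242).
[cite: CoatesLiTianZhai2015, Lemma 2.9 (general fact)] [cite: Darmon2004, Prop. 3.10 (2)]
[cite: GrossLMS1991, §4 (4.1)] -/
theorem genusPoint_not_isOfFinAddOrder_squarefree
    (W : WeierstrassCurve ℚ) [W.IsElliptic] [W.IsGloballyMinimal] [NeZero (W.conductorNorm ℤ)]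
    -- Gross's unit hypothesis `d_K ≠ −3, −4` (here `d_K < −4`), and the Heegner hypothesis
    (hdK : NumberField.discr K < -4)
    (hH : SatisfiesHeegnerHypothesis (W.conductorNorm ℤ) K)
    (Dt : ModularParametrizationData W (W.conductorNorm ℤ)) (β : ℤ)
    (hβ : (4 * (W.conductorNorm ℤ : ℤ)) ∣ β ^ 2 - NumberField.discr K)
    (y₁ : (W.baseChange (ringClassField K ι 1 : Type)).toAffine.Point)
    (hy₁ : WeierstrassCurve.Affine.Point.map (ringClassField K ι 1).subtype.toRatAlgHom y₁ =
      heegnerPointComplexOfConductor Dt (NumberField.discr K) β 1)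
    (n : ℕ) [NumberField (ringClassField K ι n)] (hn : n ≠ 0) (hsq : Squarefree n)
    (hnC : Nat.Coprime n (W.conductorNorm ℤ)) (hn2 : ¬ 2 ∣ n)
    (hnD : Nat.Coprime n (NumberField.discr K).natAbs)
    (hodd : ∀ p : ℕ, p.Prime → p ∣ n → Odd (W.frobeniusTrace p))
    (y : (W.baseChange (ringClassField K ι n : Type)).toAffine.Point)
    (hy : WeierstrassCurve.Affine.Point.map (ringClassField K ι n).subtype.toRatAlgHom y =
      heegnerPointComplexOfConductor Dt (NumberField.discr K) β n)
    (yK : (W.baseChange K).toAffine.Point)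
    (hyK : ∑ c : ringClassGal ι n ⧸ (ringClassGalOver ι n 1).subgroupOf (ringClassGal ι n),
        pointGalHom W (ringClassField K ι n) (c.out : ringClassGal ι n).1
          (WeierstrassCurve.Affine.Point.map (W' := W)
            (RingClassField.inclusion ι
              (ringClassField_mono hK ι (one_dvd n) hn)).toRingHom.toRatAlgHom y₁) =
      WeierstrassCurve.Affine.Point.map (W' := W)
        (algebraMap K (ringClassField K ι n)).toRatAlgHom yK)
    (h2L : ∀ Q : (W.baseChange (ringClassField K ι n : Type)).toAffine.Point,
      (2 : ℕ) • Q = 0 → Q = 0)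
    (hHy : ¬ ∃ R : (W.baseChange K).toAffine.Point, (2 : ℕ) • R = yK)
    (s : ringClassGal ι n → ℤˣ) :
    ¬ IsOfFinAddOrder (∑ σ : ringClassGal ι n, (s σ : ℤ) •
      pointGalHom W (ringClassField K ι n) σ.1 y) := by
  obtain ⟨m₀, hm₀, htr⟩ := exists_odd_sum_ringClassGal_eq_smul ι hK W hdK hH Dt β hβ y₁ hy₁ n hn hsq
    hnC hn2 hnD hodd y hy yK hyK
  exact genusPoint_not_isOfFinAddOrder_of_trace W hK ι hn y yK hm₀ htr h2L hHy s

end Summit.BirchSwinnertonDyer.Uniform.U2.RingClass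

end
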